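import Mathlib.LinearAlgebra.Matrix.Determinant.Basic
import Mathlib.LinearAlgebra.Matrix.Notation
import Mathlib.Data.Real.Basic
import Mathlib.Tactic.Linarith
import Mathlib.Tactic.Ring
import HarnessLib

/-!
# A weighted-torus TPP triple in `GL₃(ℝ)`: `SO(3)`, `U⁺`, `T_c·U⁻` (finite Lie exponent of `SL(3,ℝ)`)

Blasiak–Cohn–Grochow–Pratt–Umans (*Matrix multiplication via matrix groups*, arXiv:2204.03826,
Def. 4.1, §5) define the Lie exponent of a Lie group through triples of submanifolds with the triple
product property (TPP) and ask "whether the Lie exponent of `SL(n,ℝ)` is even finite".  For closed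
subgroups `H₁, H₂, H₃` the TPP is: `h₁ h₂ h₃ = 1` with `hᵢ ∈ Hᵢ` forces `h₁ = h₂ = h₃ = 1`.

**Theorem** (`soloLie_tpp_weightedTorus_fin_three`).  Let `k` be a real `3 × 3` matrix with
`kᵀ k = 1` and `det k = 1` (i.e. `k ∈ SO(3)`), `u` unit upper triangular, and `t` lower triangular
with diagonal `(d₁, d₂, d₃)`, `d₁, d₂ > 0`, subject to the single weighted-torus relation
`d₁² d₂ = 1` (the kernel `T_c` of the character `diag(d) ↦ d₁² d₂`, weights `c = (2,1,0)`; `T_c·U⁻` is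
a closed `5`-dimensional subgroup of `GL₃(ℝ)`; `d₃ > 0` is implied by `det`).  If `k * u * t = 1`
then `k = 1`, `u = 1`, `t = 1`.

So `(SO(3), U⁺, T_c U⁻)` is a TPP triple of closed connected subgroups of `GL₃(ℝ)` of dimensions
`(3,3,5)`, and `(SO(3), U⁺, (T_c ∩ SL₃)U⁻)` one of dimensions `(3,3,4)` in `SL₃(ℝ)`; with
`dim GL₃ = 9`, `r = 3` resp. `dim SL₃ = 8`, `r = 2`, Definition 4.1 gives Lie exponent
`≤ 3/(11/3 - 3) = 9/2` for `GL(3,ℝ)` and `≤ 2/(10/3 - 3) = 6` for `SL(3,ℝ)` — finite.  The general-`n`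
statement (torus `∑ⱼ (n-j) log dⱼ = 0`, giving Lie exponent `≤ 3n/(n-1)` for `GL(n,ℝ)` and
`≤ 3(n-1)/(n-2)` for `SL(n,ℝ)`) is proved on paper in the seat's note `paper/LieExponent.md`; this
file is its kernel instance `n = 3`.

Proof (the general mechanism at `n = 3`).  From `k u t = 1` and `kᵀ k = 1`: `kᵀ = u t`, so
`k₃₃ = d₃`, and `t k u = 1`, so `d₁ k₁₁ = 1`.  Rows of `k` are unit vectors, hence `k₁₁² ≤ 1`,
`k₃₃² ≤ 1`, i.e. `d₁ ≥ 1` and `d₃ ≤ 1`; `det` gives `d₁ d₂ d₃ = 1`, so `d₁ d₂ ≥ 1`.  The torus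
relation `d₁ · (d₁ d₂) = 1` then forces `d₁ = d₂ = d₃ = 1` (the leading minors `1/d₁`, `1/(d₁d₂)` of
`k` are `≤ 1` and their weighted product is pinned to `1`), whence `k₁₁ = k₃₃ = 1`, `k` is diagonal,
`k₂₂ = det k = 1`, and finally `u t = kᵀ = 1` gives `u = t = 1`. ∎
-/

namespace Summit.MatrixMultiplication.MatrixMultiplication.Theorems

set_option linter.dupNamespace false

open Matrix

set_option maxHeartbeats 400000 in
/-- The weighted-torus triple `(SO(3), U⁺, T_c U⁻)` in `GL₃(ℝ)` has the triple product property
(subgroup form): `k * u * t = 1` with `k ∈ SO(3)`, `u` unit upper triangular, `t` lower triangular with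
diagonal `d₁, d₂ > 0` (then `d₃ > 0` automatically) satisfying `d₁² d₂ = 1` forces `k = 1`, `u = 1`,
`t = 1`.  Kernel instance `n = 3`
of the seat's finite-Lie-exponent theorem for `SL(n,ℝ)` / `GL(n,ℝ)` (BCGPU 2022, §5, the question
whether the Lie exponent of `SL(n,ℝ)` is finite). [new] -/
theorem soloLie_tpp_weightedTorus_fin_three (k : Matrix (Fin 3) (Fin 3) ℝ)
    (hk : kᵀ * k = 1) (hdet : k.det = 1)
    (a b c x y z d₁ d₂ d₃ : ℝ) (h₁ : 0 < d₁) (h₂ : 0 < d₂)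
    (hT : d₁ * d₁ * d₂ = 1)
    (h : k * !![1, a, b; 0, 1, c; 0, 0, 1] * !![d₁, 0, 0; x, d₂, 0; y, z, d₃] = 1) :
    k = 1 ∧ (!![1, a, b; 0, 1, c; 0, 0, 1] : Matrix (Fin 3) (Fin 3) ℝ) = 1 ∧
      (!![d₁, 0, 0; x, d₂, 0; y, z, d₃] : Matrix (Fin 3) (Fin 3) ℝ) = 1 := by
  -- k * (u * t) = 1, hence (u * t) * k = 1, kᵀ = u * t, t * k * u = 1, k * kᵀ = 1
  have hkut : k * (!![1, a, b; 0, 1, c; 0, 0, 1] * !![d₁, 0, 0; x, d₂, 0; y, z, d₃]) = 1 := by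
    rw [← Matrix.mul_assoc]; exact h
  have hutk : !![1, a, b; 0, 1, c; 0, 0, 1] * !![d₁, 0, 0; x, d₂, 0; y, z, d₃] * k = 1 :=
    mul_eq_one_comm.mp hkut
  have hkT : kᵀ = !![1, a, b; 0, 1, c; 0, 0, 1] * !![d₁, 0, 0; x, d₂, 0; y, z, d₃] := by
    calc kᵀ = kᵀ * (k * (!![1, a, b; 0, 1, c; 0, 0, 1] * !![d₁, 0, 0; x, d₂, 0; y, z, d₃])) := by
            rw [hkut, Matrix.mul_one]
      _ = kᵀ * k * (!![1, a, b; 0, 1, c; 0, 0, 1] * !![d₁, 0, 0; x, d₂, 0; y, z, d₃]) := by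
            rw [Matrix.mul_assoc]
      _ = !![1, a, b; 0, 1, c; 0, 0, 1] * !![d₁, 0, 0; x, d₂, 0; y, z, d₃] := by
            rw [hk, Matrix.one_mul]
  have htku : !![d₁, 0, 0; x, d₂, 0; y, z, d₃] * k * !![1, a, b; 0, 1, c; 0, 0, 1] = 1 := by
    have h' : !![1, a, b; 0, 1, c; 0, 0, 1] * (!![d₁, 0, 0; x, d₂, 0; y, z, d₃] * k) = 1 := by
      rw [← Matrix.mul_assoc]; exact hutk
    exact mul_eq_one_comm.mp h'
  have hkkT : k * kᵀ = 1 := mul_eq_one_comm.mp hk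
  -- determinant: det t = d₁ d₂ d₃ = 1
  have hdt : d₁ * d₂ * d₃ = 1 := by
    have hd := congrArg Matrix.det h
    rw [Matrix.det_mul, Matrix.det_mul, hdet, Matrix.det_one] at hd
    have hdu : Matrix.det (!![1, a, b; 0, 1, c; 0, 0, 1] : Matrix (Fin 3) (Fin 3) ℝ) = 1 := by
      simp [Matrix.det_fin_three]
    have hdt' : Matrix.det (!![d₁, 0, 0; x, d₂, 0; y, z, d₃] : Matrix (Fin 3) (Fin 3) ℝ)
        = d₁ * d₂ * d₃ := by
      simp [Matrix.det_fin_three]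
    rw [hdu, hdt'] at hd
    linarith
  -- scalar consequences of the matrix identities
  have e33 : k 2 2 = d₃ := by
    have h' := congrFun (congrFun hkT 2) 2
    simp only [Matrix.transpose_apply, Matrix.mul_apply, Fin.sum_univ_three] at h'
    simpa using h'
  have e11 : d₁ * k 0 0 = 1 := by
    have h' := congrFun (congrFun htku 0) 0
    simp only [Matrix.mul_apply, Fin.sum_univ_three] at h'
    simpa using h'
  have r0 : k 0 0 * k 0 0 + k 0 1 * k 0 1 + k 0 2 * k 0 2 = 1 := by
    have h' := congrFun (congrFun hkkT 0) 0
    simp only [Matrix.transpose_apply, Matrix.mul_apply, Fin.sum_univ_three] at h'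
    simpa using h'
  have r2 : k 2 0 * k 2 0 + k 2 1 * k 2 1 + k 2 2 * k 2 2 = 1 := by
    have h' := congrFun (congrFun hkkT 2) 2
    simp only [Matrix.transpose_apply, Matrix.mul_apply, Fin.sum_univ_three] at h'
    simpa using h'
  have c0 : k 0 0 * k 0 0 + k 1 0 * k 1 0 + k 2 0 * k 2 0 = 1 := by
    have h' := congrFun (congrFun hk 0) 0
    simp only [Matrix.transpose_apply, Matrix.mul_apply, Fin.sum_univ_three] at h'
    simpa using h'
  have c2 : k 0 2 * k 0 2 + k 1 2 * k 1 2 + k 2 2 * k 2 2 = 1 := by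
    have h' := congrFun (congrFun hk 2) 2
    simp only [Matrix.transpose_apply, Matrix.mul_apply, Fin.sum_univ_three] at h'
    simpa using h'
  -- the torus pinning: d₁ ≥ 1, d₃ ≤ 1, d₁ d₂ ≥ 1, and d₁ (d₁ d₂) = 1 force d₁ = d₂ = d₃ = 1
  have hk00sq : k 0 0 * k 0 0 ≤ 1 := by
    linarith only [r0, mul_self_nonneg (k 0 1), mul_self_nonneg (k 0 2)]
  have hsq1 : (d₁ * k 0 0) * (d₁ * k 0 0) = 1 := by rw [e11, one_mul]
  have hd1sq : 1 ≤ d₁ * d₁ := by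
    nlinarith only [hsq1, hk00sq, mul_self_nonneg d₁,
      mul_nonneg (mul_self_nonneg d₁) (sub_nonneg.mpr hk00sq)]
  have hd1 : 1 ≤ d₁ := by nlinarith only [hd1sq, h₁]
  have hk22sq : k 2 2 * k 2 2 ≤ 1 := by
    linarith only [r2, mul_self_nonneg (k 2 0), mul_self_nonneg (k 2 1)]
  have hd3sq : d₃ * d₃ ≤ 1 := by rw [← e33]; exact hk22sq
  have hd3 : d₃ ≤ 1 := by nlinarith only [hd3sq]
  have hd12 : 1 ≤ d₁ * d₂ := by
    nlinarith only [hdt, hd3, mul_pos h₁ h₂, mul_nonneg (mul_pos h₁ h₂).le (sub_nonneg.mpr hd3)]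
  have hsum : d₁ + d₁ * d₂ ≤ 2 := by
    nlinarith only [hT, hd1, hd12, mul_nonneg (sub_nonneg.mpr hd1) (sub_nonneg.mpr hd12)]
  have hd1eq : d₁ = 1 := by linarith only [hsum, hd1, hd12]
  have hd12eq : d₁ * d₂ = 1 := by linarith only [hsum, hd1, hd12]
  have hd2eq : d₂ = 1 := by rw [hd1eq, one_mul] at hd12eq; exact hd12eq
  have hd3eq : d₃ = 1 := by
    rw [hd1eq, hd2eq] at hdt; linarith only [hdt]
  have k00 : k 0 0 = 1 := by rw [hd1eq, one_mul] at e11; exact e11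
  have k22 : k 2 2 = 1 := by rw [e33, hd3eq]
  -- k is diagonal with k₂₂ pinned by det
  have r0' : k 0 1 * k 0 1 + k 0 2 * k 0 2 = 0 := by rw [k00] at r0; linarith only [r0]
  have c0' : k 1 0 * k 1 0 + k 2 0 * k 2 0 = 0 := by rw [k00] at c0; linarith only [c0]
  have r2' : k 2 0 * k 2 0 + k 2 1 * k 2 1 = 0 := by rw [k22] at r2; linarith only [r2]
  have c2' : k 0 2 * k 0 2 + k 1 2 * k 1 2 = 0 := by rw [k22] at c2; linarith only [c2]
  have k01 : k 0 1 = 0 := mul_self_eq_zero.mp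
    (by linarith only [r0', mul_self_nonneg (k 0 1), mul_self_nonneg (k 0 2)])
  have k02 : k 0 2 = 0 := mul_self_eq_zero.mp
    (by linarith only [r0', mul_self_nonneg (k 0 1), mul_self_nonneg (k 0 2)])
  have k10 : k 1 0 = 0 := mul_self_eq_zero.mp
    (by linarith only [c0', mul_self_nonneg (k 1 0), mul_self_nonneg (k 2 0)])
  have k20 : k 2 0 = 0 := mul_self_eq_zero.mp
    (by linarith only [c0', mul_self_nonneg (k 1 0), mul_self_nonneg (k 2 0)])
  have k21 : k 2 1 = 0 := mul_self_eq_zero.mp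
    (by linarith only [r2', mul_self_nonneg (k 2 0), mul_self_nonneg (k 2 1)])
  have k12 : k 1 2 = 0 := mul_self_eq_zero.mp
    (by linarith only [c2', mul_self_nonneg (k 0 2), mul_self_nonneg (k 1 2)])
  have k11 : k 1 1 = 1 := by
    have hd := hdet
    rw [Matrix.det_fin_three, k00, k01, k02, k10, k12, k20, k21, k22] at hd
    linarith only [hd]
  have hk1 : k = 1 := by
    rw [Matrix.eta_fin_three k, k00, k01, k02, k10, k11, k12, k20, k21, k22, Matrix.one_fin_three]
  -- u t = kᵀ = 1 pins u and t
  have hut1 : !![1, a, b; 0, 1, c; 0, 0, 1] * !![(1 : ℝ), 0, 0; x, 1, 0; y, z, 1] = 1 := by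
    have h' := hkT.symm
    rw [hk1, Matrix.transpose_one, hd1eq, hd2eq, hd3eq] at h'
    exact h'
  have hb : b = 0 := by
    have h' := congrFun (congrFun hut1 0) 2
    simp only [Matrix.mul_apply, Fin.sum_univ_three] at h'
    simpa [Matrix.one_apply] using h'
  have hc : c = 0 := by
    have h' := congrFun (congrFun hut1 1) 2
    simp only [Matrix.mul_apply, Fin.sum_univ_three] at h'
    simpa [Matrix.one_apply] using h'
  have ey : y = 0 := by
    have h' := congrFun (congrFun hut1 2) 0
    simp only [Matrix.mul_apply, Fin.sum_univ_three] at h'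
    simpa [Matrix.one_apply] using h'
  have ez : z = 0 := by
    have h' := congrFun (congrFun hut1 2) 1
    simp only [Matrix.mul_apply, Fin.sum_univ_three] at h'
    simpa [Matrix.one_apply] using h'
  have hx : x = 0 := by
    have h' := congrFun (congrFun hut1 1) 0
    simp only [Matrix.mul_apply, Fin.sum_univ_three] at h'
    simpa [Matrix.one_apply, hc, ey] using h'
  have ha : a = 0 := by
    have h' := congrFun (congrFun hut1 0) 1
    simp only [Matrix.mul_apply, Fin.sum_univ_three] at h'
    simpa [Matrix.one_apply, hb, ez] using h'
  refine ⟨hk1, ?_, ?_⟩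
  · rw [ha, hb, hc, Matrix.one_fin_three]
  · rw [hx, ey, ez, hd1eq, hd2eq, hd3eq, Matrix.one_fin_three]

end Summit.MatrixMultiplication.MatrixMultiplication.Theorems
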